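import Mathlib
import HarnessLib
import Summits.HubbardSuperconductivity.HubbardSuperconductivity.Theorems.KLProgrammeKLRegimeTwoVolumeGridPeriodisationLegs
import Summits.HubbardSuperconductivity.HubbardSuperconductivity.Theorems.KLProgrammeKLRegimeTwoVolumeTorusBlocks
import Summits.HubbardSuperconductivity.HubbardSuperconductivity.Theorems.KLProgrammeSectorisedLegKernelsDefs
import Literature.MathematicalPhysics.QuantumLattice.HubbardSpaceTimeCharacters

/-!
# Route `KLProgramme` — crux K3, the nested two-volume pass AT THE SECTORISED SCALES `n ≥ 1`: block structure, periodisation (P), antisymmetry /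
# selection rules and the far geometry for the SECTOR-FIELD covariances `Sᵀ C S` (cell gate-hubbard-kl, seat hubbard-kl-k3c4-p1 g8; `--supports` stmt-…-20440)

At scale `0` the two-volume kit runs on `GridLeg (GridPoint V N)` with the grid pull-backs of `hubbardGridSub` (p520597, p519907).  At the scales `n ≥ 1` the
engine's single-scale step is the SECTORISED one (`Literature.…SectorisedEffectiveActionBound*`): the determinant-bounded step runs on the auxiliary
SECTOR-FIELD algebra with labels `SpaceTimeIdx V M × SectorLeg Ns` and covariance `Sᵀ C S`, `S = sectorSubMatrix V M β F` (`HubbardSectorFieldSubstitution`;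
the engine's (E1-W) profiles `klWtPinnedSum` live on exactly these labels).  The abstract two-volume STEP `…TwoVolumeInductiveStep.sum_norm_kernel_twoVolume_step_le`
(p539598) is label-agnostic; this file supplies its model inputs on these labels for two nested tori `Lf = b·L` (same `M`, same sector family):
§1 the block structure `e` (block `(⌊x_i/L⌋)_i` of the SITE, projection `((x₀, x⃗), ℓ) ↦ ((x₀, red x⃗), ℓ)`) and its fibres; §2–§3 **(P) at every pair of legs**
(`sectorPullback_periodise_leg`, hypothesis `hP`; also of k3c5-p2's response door p533565) for SAMPLED multiplier families `F_V ω (i,q) = 𝔣 ω i (p_q)` and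
SAMPLED symbols `p_V((i,q),σ) = (βV²)·Φ i σ (p_q)` — the `ψ⁺ψ⁻` phase is a product-torus character (`conj_hubbardPlaneWave_mul_conj_hubbardPlaneWave`) and the
spatial character sum periodises exactly (`periodise_spatialPropagator(_left)`); the entrywise antisymmetry `sectorPullback_swap` (`hC't`) and the spin selection
rule; §4 (G1)/(G2) `sector_far_of_block_ne/_fibre_ne` (`hG1`/`hG2`, `Far X′ Y′ := R < tnorm (site X′ − site Y′)`); §5 the programme's anisotropic family
`klAnisoFamily` is sampled (one `𝔣` at every volume, at a COMMON frame).  Everything is proved; no definition; nothing is asserted about the model.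
References: BGM 2006 §2.1 (2.2)–(2.5), §2.5 (2.48), §2.7 (2.66); the cell's VL-STUB-ROUTE-A-g8.md §3 and TWO-VOLUME-KIT.md (k3c4-p1).
-/

noncomputable section

namespace Summit.HubbardSuperconductivity.HubbardSuperconductivity.Theorems.TwoPointAssembly

set_option linter.dupNamespace false -- summit = problem name (single-conjunct summit), D-0017

open Finset Complex Literature.MathematicalPhysics.QuantumLattice Literature.Probability.LatticeModels
open Summit.HubbardSuperconductivity.HubbardSuperconductivity.Theorems.TwoVolumeDefect
open scoped ComplexConjugate

/-! ## §1 The block structure of the sector-field labels over the nested torus -/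

section Blocks

variable {b L Lf : ℕ} [NeZero Lf] [NeZero L]

/-- **THE BLOCK STRUCTURE OF THE SECTOR-FIELD LABELS** over the nested torus `Lf = b·L` (time index and sector leg untouched): a bijection
`(SpaceTimeIdx Lf M × SectorLeg Ns) ≃ (Fin 2 → Fin b) × (SpaceTimeIdx L M × SectorLeg Ns)` with block `(⌊x_i/L⌋)_i` of the site and projection
`((x₀, x⃗), ℓ) ↦ ((x₀, red x⃗), ℓ)`. [folklore] -/
theorem exists_sectorFieldBlockEquiv (hLf : Lf = b * L) (M Ns : ℕ) :
    ∃ e : (SpaceTimeIdx Lf M × SectorLeg Ns) ≃ (Fin 2 → Fin b) × (SpaceTimeIdx L M × SectorLeg Ns),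
      (∀ X' i, ((e X').1 i : ℕ) = (X'.1.2 i).val / L) ∧
        (∀ X', (e X').2 = ((X'.1.1, fun i => (((X'.1.2 i).val : ℕ) : ZMod L)), X'.2)) := by
  obtain ⟨eS, hS1, hS2⟩ := exists_siteBlockEquiv (d := 2) hLf
  refine ⟨{ toFun := fun X' => ((eS X'.1.2).1, ((X'.1.1, (eS X'.1.2).2), X'.2))
            invFun := fun p => ((p.2.1.1, eS.symm (p.1, p.2.1.2)), p.2.2)
            left_inv := ?_
            right_inv := ?_ }, fun X' i => hS1 _ i, fun X' => by
              show ((X'.1.1, (eS X'.1.2).2), X'.2) = _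
              rw [hS2]⟩
  · rintro ⟨⟨x₀, x⟩, ℓ⟩; simp
  · rintro ⟨q, ⟨⟨x₀, y⟩, ℓ⟩⟩; simp

omit [NeZero L] in
/-- **A fibre of the label projection is a fibre of the site reduction** (time and sector leg are read off the target label). [folklore] -/
theorem sum_fibre_sectorField {M Ns : ℕ} {ι : Type*} {A : Type*} [AddCommMonoid A]
    (e : (SpaceTimeIdx Lf M × SectorLeg Ns) ≃ ι × (SpaceTimeIdx L M × SectorLeg Ns))
    (he2 : ∀ X', (e X').2 = ((X'.1.1, fun i => (((X'.1.2 i).val : ℕ) : ZMod L)), X'.2))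
    (G : SpaceTimeIdx Lf M × SectorLeg Ns → A) (Y : SpaceTimeIdx L M × SectorLeg Ns) :
    ∑ Y'' ∈ univ.filter (fun Y'' : SpaceTimeIdx Lf M × SectorLeg Ns => (e Y'').2 = Y), G Y'' =
      ∑ x' ∈ univ.filter (fun x' : TorusSite 2 Lf => (fun i => (((x' i).val : ℕ) : ZMod L)) = Y.1.2), G ((Y.1.1, x'), Y.2) := by
  classical
  refine Finset.sum_bij' (fun Y'' _ => Y''.1.2) (fun x' _ => ((Y.1.1, x'), Y.2)) ?_ ?_ ?_ ?_ ?_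
  · intro Y'' hY''
    simp only [mem_filter, mem_univ, true_and] at hY'' ⊢
    rw [he2] at hY''; rw [← hY'']
  · intro x' hx'
    simp only [mem_filter, mem_univ, true_and] at hx' ⊢
    rw [he2, hx']
  · intro Y'' hY''
    simp only [mem_filter, mem_univ, true_and] at hY''
    rw [he2] at hY''; rw [← hY'']
  · intro x' hx'; rfl
  · intro Y'' hY''
    simp only [mem_filter, mem_univ, true_and] at hY''
    rw [he2] at hY''; rw [← hY'']

end Blocks

/-! ## §2 The sector-field covariance `Sᵀ (normalCovariance p) S`: antisymmetry, spin selection, closed forms, and the `(+,−)` / `(−,+)` entries periodise -/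

section Pullback

variable {b L Lf M Ns : ℕ} [NeZero Lf] [NeZero L]

/-- **Entrywise antisymmetry** of the sector-field covariance: `C′ Y′ Y = −C′ Y Y′` (hypothesis `hC't` of the two-volume STEP). [folklore] -/
theorem sectorPullback_swap {V : ℕ} [NeZero V] (β : ℝ) (F : Fin Ns → FreqMomentum V M → ℂ) (p : FreqMomentum V M × Fin 2 → ℂ)
    (Y Y' : SpaceTimeIdx V M × SectorLeg Ns) :
    ((sectorSubMatrix V M β F).transpose * normalCovariance V M p * sectorSubMatrix V M β F) Y' Y =
      -((sectorSubMatrix V M β F).transpose * normalCovariance V M p * sectorSubMatrix V M β F) Y Y' := by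
  have h := congrFun (congrFun (pullback_normalCovariance_transpose (L := V) (M := M) β F p) Y) Y'
  rwa [Matrix.transpose_apply, Matrix.neg_apply] at h

/-- **Spin selection**: the sector-field covariance of a normal covariance vanishes between legs of different spin. [folklore] -/
theorem sectorPullback_apply_of_spin_ne {V : ℕ} [NeZero V] (β : ℝ) (F : Fin Ns → FreqMomentum V M → ℂ)
    (p : FreqMomentum V M × Fin 2 → ℂ) {Y Y' : SpaceTimeIdx V M × SectorLeg Ns} (h : Y.2.1.2 ≠ Y'.2.1.2) :
    ((sectorSubMatrix V M β F).transpose * normalCovariance V M p * sectorSubMatrix V M β F) Y Y' = 0 := by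
  rw [sectorSub_pullback_normalCovariance_apply, if_neg h]

/-- **Closed form of a `(+,−)` entry** (equal spins): one momentum sum, the symbol `+p`. [folklore] -/
theorem sectorPullback_apply_zero_one {V : ℕ} [NeZero V] (β : ℝ) (F : Fin Ns → FreqMomentum V M → ℂ) (p : FreqMomentum V M × Fin 2 → ℂ)
    (x₀ : ImagTimeIdx M) (x : TorusSite 2 V) (y₀ : ImagTimeIdx M) (y : TorusSite 2 V) (ω ω' : Fin Ns) (σ : Fin 2) :
    ((sectorSubMatrix V M β F).transpose * normalCovariance V M p * sectorSubMatrix V M β F) ((x₀, x), ((ω, σ), 0)) ((y₀, y), ((ω', σ), 1)) =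
      ∑ k : FreqMomentum V M,
        (((1 / (β * (V : ℝ) ^ 2) : ℝ) : ℂ) * (F ω k * conj (hubbardPlaneWave V M β 0 k (x₀, x)))) * p (k, σ) *
          ((((1 / (β * (V : ℝ) ^ 2) : ℝ) : ℂ) * (F ω' k * conj (hubbardPlaneWave V M β 1 k (y₀, y))))) := by
  have h01 : ((((x₀, x), ((ω, σ), (0 : Fin 2))) : SpaceTimeIdx V M × SectorLeg Ns)).2.2 = 0 ∧
      ((((y₀, y), ((ω', σ), (1 : Fin 2))) : SpaceTimeIdx V M × SectorLeg Ns)).2.2 = 1 := ⟨rfl, rfl⟩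
  rw [sectorSub_pullback_normalCovariance_apply, if_pos rfl]
  exact Finset.sum_congr rfl fun k _ => by rw [if_pos h01]

/-- **Closed form of a `(−,+)` entry** (equal spins): one momentum sum, the symbol `−p`. [folklore] -/
theorem sectorPullback_apply_one_zero {V : ℕ} [NeZero V] (β : ℝ) (F : Fin Ns → FreqMomentum V M → ℂ) (p : FreqMomentum V M × Fin 2 → ℂ)
    (x₀ : ImagTimeIdx M) (x : TorusSite 2 V) (y₀ : ImagTimeIdx M) (y : TorusSite 2 V) (ω ω' : Fin Ns) (σ : Fin 2) :
    ((sectorSubMatrix V M β F).transpose * normalCovariance V M p * sectorSubMatrix V M β F) ((x₀, x), ((ω, σ), 1)) ((y₀, y), ((ω', σ), 0)) =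
      ∑ k : FreqMomentum V M,
        (((1 / (β * (V : ℝ) ^ 2) : ℝ) : ℂ) * (F ω k * conj (hubbardPlaneWave V M β 1 k (x₀, x)))) * (-p (k, σ)) *
          ((((1 / (β * (V : ℝ) ^ 2) : ℝ) : ℂ) * (F ω' k * conj (hubbardPlaneWave V M β 0 k (y₀, y))))) := by
  have h10 : ¬ (((((x₀, x), ((ω, σ), (1 : Fin 2))) : SpaceTimeIdx V M × SectorLeg Ns)).2.2 = 0 ∧
      ((((y₀, y), ((ω', σ), (0 : Fin 2))) : SpaceTimeIdx V M × SectorLeg Ns)).2.2 = 1) := fun h => absurd h.1 (show ¬((1 : Fin 2) = 0) by decide)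
  have h10' : ((((x₀, x), ((ω, σ), (1 : Fin 2))) : SpaceTimeIdx V M × SectorLeg Ns)).2.2 = 1 ∧
      ((((y₀, y), ((ω', σ), (0 : Fin 2))) : SpaceTimeIdx V M × SectorLeg Ns)).2.2 = 0 := ⟨rfl, rfl⟩
  rw [sectorSub_pullback_normalCovariance_apply, if_pos rfl]
  exact Finset.sum_congr rfl fun k _ => by rw [if_neg h10, if_pos h10']

/-- One frequency, one volume, `(+,−)` orientation: the summand of `sectorPullback_apply_zero_one` with a SAMPLED multiplier family `F ω (i,q) = 𝔣 ω i (p_q)` and a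
SAMPLED symbol `p ((i,q),σ) = (βV²)·Φ i σ (p_q)` is `(βV²)⁻² · (T_i(x₀,y₀) · χ_q(x⃗ − y⃗)) · ((βV²) · ψ_i(p_q))`, `T` the (volume-free) temporal phase of
`conj_hubbardPlaneWave_mul_conj_hubbardPlaneWave`, `ψ_i(p) = 𝔣 ω i p · 𝔣 ω′ i p · Φ i σ p`. [folklore] -/
theorem sectorSummand_zero_one_eq {V : ℕ} [NeZero V] [NeZero M] {β : ℝ} (hβ : β ≠ 0)
    (𝔣 : Fin Ns → MatsubaraIdx M → (Fin 2 → ℝ) → ℂ) (Φ : MatsubaraIdx M → Fin 2 → (Fin 2 → ℝ) → ℂ)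
    (F : Fin Ns → FreqMomentum V M → ℂ) (hF : ∀ ω i q, F ω (i, q) = 𝔣 ω i (latticeMomentum V q))
    (p : FreqMomentum V M × Fin 2 → ℂ) (hp : ∀ i q σ, p ((i, q), σ) = ((β * (V : ℝ) ^ 2 : ℝ) : ℂ) * Φ i σ (latticeMomentum V q))
    (x₀ y₀ : ImagTimeIdx M) (x y : TorusSite 2 V) (ω ω' : Fin Ns) (σ : Fin 2)
    (ψ : MatsubaraIdx M → (Fin 2 → ℝ) → ℂ) (hψ : ∀ i q', 𝔣 ω i q' * 𝔣 ω' i q' * Φ i σ q' = ψ i q') (i : MatsubaraIdx M) (q : TorusSite 2 V) :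
    (((1 / (β * (V : ℝ) ^ 2) : ℝ) : ℂ) * (F ω (i, q) * conj (hubbardPlaneWave V M β 0 (i, q) (x₀, x)))) * p ((i, q), σ) *
        ((((1 / (β * (V : ℝ) ^ 2) : ℝ) : ℂ) * (F ω' (i, q) * conj (hubbardPlaneWave V M β 1 (i, q) (y₀, y))))) =
      (((1 / (β * (V : ℝ) ^ 2) : ℝ) : ℂ)) ^ 2 *
        ((Complex.exp (((Real.pi * (1 - 2 * M) * (((x₀ : ℕ) : ℝ) - ((y₀ : ℕ) : ℝ)) / (2 * M) : ℝ) : ℂ) * I) *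
            torusChar (fun _ : Fin 1 => ((i : ℕ) : ZMod (2 * M))) (fun _ : Fin 1 => ((x₀ : ℕ) : ZMod (2 * M)) - ((y₀ : ℕ) : ZMod (2 * M)))) *
          torusChar q (x - y) * (((β * (V : ℝ) ^ 2 : ℝ) : ℂ) * ψ i (latticeMomentum V q))) := by
  have hpw := conj_hubbardPlaneWave_mul_conj_hubbardPlaneWave (L := V) (M := M) hβ (i, q) (x₀, x) (y₀, y)
  dsimp only at hpw
  rw [hF, hF, hp, ← hψ]
  calc _ = (((1 / (β * (V : ℝ) ^ 2) : ℝ) : ℂ)) ^ 2 *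
          ((conj (hubbardPlaneWave V M β 0 (i, q) (x₀, x)) * conj (hubbardPlaneWave V M β 1 (i, q) (y₀, y))) *
            (((β * (V : ℝ) ^ 2 : ℝ) : ℂ) * (𝔣 ω i (latticeMomentum V q) * 𝔣 ω' i (latticeMomentum V q) * Φ i σ (latticeMomentum V q)))) := by
        ring
    _ = _ := by rw [hpw]; ring

/-- One frequency, one volume, `(−,+)` orientation: spatial character `χ_q(y⃗ − x⃗)`, temporal phase at `(y₀, x₀)`, sign of the normal covariance. [folklore] -/
theorem sectorSummand_one_zero_eq {V : ℕ} [NeZero V] [NeZero M] {β : ℝ} (hβ : β ≠ 0)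
    (𝔣 : Fin Ns → MatsubaraIdx M → (Fin 2 → ℝ) → ℂ) (Φ : MatsubaraIdx M → Fin 2 → (Fin 2 → ℝ) → ℂ)
    (F : Fin Ns → FreqMomentum V M → ℂ) (hF : ∀ ω i q, F ω (i, q) = 𝔣 ω i (latticeMomentum V q))
    (p : FreqMomentum V M × Fin 2 → ℂ) (hp : ∀ i q σ, p ((i, q), σ) = ((β * (V : ℝ) ^ 2 : ℝ) : ℂ) * Φ i σ (latticeMomentum V q))
    (x₀ y₀ : ImagTimeIdx M) (x y : TorusSite 2 V) (ω ω' : Fin Ns) (σ : Fin 2)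
    (ψ : MatsubaraIdx M → (Fin 2 → ℝ) → ℂ) (hψ : ∀ i q', 𝔣 ω i q' * 𝔣 ω' i q' * Φ i σ q' = ψ i q') (i : MatsubaraIdx M) (q : TorusSite 2 V) :
    (((1 / (β * (V : ℝ) ^ 2) : ℝ) : ℂ) * (F ω (i, q) * conj (hubbardPlaneWave V M β 1 (i, q) (x₀, x)))) * (-p ((i, q), σ)) *
        ((((1 / (β * (V : ℝ) ^ 2) : ℝ) : ℂ) * (F ω' (i, q) * conj (hubbardPlaneWave V M β 0 (i, q) (y₀, y))))) =
      (((1 / (β * (V : ℝ) ^ 2) : ℝ) : ℂ)) ^ 2 *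
        ((-(Complex.exp (((Real.pi * (1 - 2 * M) * (((y₀ : ℕ) : ℝ) - ((x₀ : ℕ) : ℝ)) / (2 * M) : ℝ) : ℂ) * I) *
            torusChar (fun _ : Fin 1 => ((i : ℕ) : ZMod (2 * M))) (fun _ : Fin 1 => ((y₀ : ℕ) : ZMod (2 * M)) - ((x₀ : ℕ) : ZMod (2 * M))))) *
          torusChar q (y - x) * (((β * (V : ℝ) ^ 2 : ℝ) : ℂ) * ψ i (latticeMomentum V q))) := by
  have hpw := conj_hubbardPlaneWave_mul_conj_hubbardPlaneWave (L := V) (M := M) hβ (i, q) (y₀, y) (x₀, x)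
  dsimp only at hpw
  rw [hF, hF, hp, ← hψ]
  calc _ = (((1 / (β * (V : ℝ) ^ 2) : ℝ) : ℂ)) ^ 2 *
          (-(conj (hubbardPlaneWave V M β 0 (i, q) (y₀, y)) * conj (hubbardPlaneWave V M β 1 (i, q) (x₀, x))) *
            (((β * (V : ℝ) ^ 2 : ℝ) : ℂ) * (𝔣 ω i (latticeMomentum V q) * 𝔣 ω' i (latticeMomentum V q) * Φ i σ (latticeMomentum V q)))) := by
        ring
    _ = _ := by rw [hpw]; ring

/-- **The `(+,−)` entries of the sector-field covariance periodise EXACTLY between nested tori.**  For `Lf = b·L`, `β ≠ 0`, the SAME sampled multiplier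
family `𝔣` and symbol `Φ` at both volumes: `Σ_{red y⃗′ = ȳ} C′_{Lf}(((x₀,x⃗),(ω,σ,+)),((y₀,y⃗′),(ω′,σ,−))) = C_L(((x₀, red x⃗),(ω,σ,+)),((y₀,ȳ),(ω′,σ,−)))`.
[folklore] -/
theorem sectorPullback_zero_one_periodise [NeZero M] (hLf : Lf = b * L) {β : ℝ} (hβ : β ≠ 0)
    (𝔣 : Fin Ns → MatsubaraIdx M → (Fin 2 → ℝ) → ℂ) (Φ : MatsubaraIdx M → Fin 2 → (Fin 2 → ℝ) → ℂ)
    (FL : Fin Ns → FreqMomentum L M → ℂ) (FLf : Fin Ns → FreqMomentum Lf M → ℂ)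
    (hFL : ∀ ω i q, FL ω (i, q) = 𝔣 ω i (latticeMomentum L q)) (hFLf : ∀ ω i q, FLf ω (i, q) = 𝔣 ω i (latticeMomentum Lf q))
    (pL : FreqMomentum L M × Fin 2 → ℂ) (pLf : FreqMomentum Lf M × Fin 2 → ℂ)
    (hpL : ∀ i q σ, pL ((i, q), σ) = ((β * (L : ℝ) ^ 2 : ℝ) : ℂ) * Φ i σ (latticeMomentum L q))
    (hpLf : ∀ i q σ, pLf ((i, q), σ) = ((β * (Lf : ℝ) ^ 2 : ℝ) : ℂ) * Φ i σ (latticeMomentum Lf q))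
    (x₀ y₀ : ImagTimeIdx M) (x : TorusSite 2 Lf) (ybar : TorusSite 2 L) (ω ω' : Fin Ns) (σ : Fin 2) :
    ∑ y' ∈ univ.filter (fun y' : TorusSite 2 Lf => (fun i => (((y' i).val : ℕ) : ZMod L)) = ybar),
        ((sectorSubMatrix Lf M β FLf).transpose * normalCovariance Lf M pLf * sectorSubMatrix Lf M β FLf)
          ((x₀, x), ((ω, σ), 0)) ((y₀, y'), ((ω', σ), 1)) =
      ((sectorSubMatrix L M β FL).transpose * normalCovariance L M pL * sectorSubMatrix L M β FL)
        ((x₀, fun i => (((x i).val : ℕ) : ZMod L)), ((ω, σ), 0)) ((y₀, ybar), ((ω', σ), 1)) := by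
  obtain ⟨ψ, hψ⟩ : ∃ ψ : MatsubaraIdx M → (Fin 2 → ℝ) → ℂ, ∀ i q', 𝔣 ω i q' * 𝔣 ω' i q' * Φ i σ q' = ψ i q' := ⟨_, fun _ _ => rfl⟩
  have hfine : ∀ y' : TorusSite 2 Lf,
      ((sectorSubMatrix Lf M β FLf).transpose * normalCovariance Lf M pLf * sectorSubMatrix Lf M β FLf)
          ((x₀, x), ((ω, σ), 0)) ((y₀, y'), ((ω', σ), 1)) =
        ∑ i : MatsubaraIdx M,
          (Complex.exp (((Real.pi * (1 - 2 * M) * (((x₀ : ℕ) : ℝ) - ((y₀ : ℕ) : ℝ)) / (2 * M) : ℝ) : ℂ) * I) *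
              torusChar (fun _ : Fin 1 => ((i : ℕ) : ZMod (2 * M))) (fun _ : Fin 1 => ((x₀ : ℕ) : ZMod (2 * M)) - ((y₀ : ℕ) : ZMod (2 * M)))) /
              (β : ℂ) *
            (((Lf : ℂ) ^ 2)⁻¹ * ∑ q : TorusSite 2 Lf, ψ i (latticeMomentum Lf q) * torusChar q (x - y')) := by
    intro y'
    rw [sectorPullback_apply_zero_one, Fintype.sum_prod_type]
    refine Finset.sum_congr rfl fun i _ => ?_
    exact (Finset.sum_congr rfl fun q _ => sectorSummand_zero_one_eq hβ 𝔣 Φ FLf hFLf pLf hpLf x₀ y₀ x y' ω ω' σ ψ hψ i q).trans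
      (sum_gridSummand_eq hβ _ (ψ i) (x - y'))
  have hcoarse :
      ((sectorSubMatrix L M β FL).transpose * normalCovariance L M pL * sectorSubMatrix L M β FL)
          ((x₀, fun i => (((x i).val : ℕ) : ZMod L)), ((ω, σ), 0)) ((y₀, ybar), ((ω', σ), 1)) =
        ∑ i : MatsubaraIdx M,
          (Complex.exp (((Real.pi * (1 - 2 * M) * (((x₀ : ℕ) : ℝ) - ((y₀ : ℕ) : ℝ)) / (2 * M) : ℝ) : ℂ) * I) *
              torusChar (fun _ : Fin 1 => ((i : ℕ) : ZMod (2 * M))) (fun _ : Fin 1 => ((x₀ : ℕ) : ZMod (2 * M)) - ((y₀ : ℕ) : ZMod (2 * M)))) /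
              (β : ℂ) *
            (((L : ℂ) ^ 2)⁻¹ * ∑ q : TorusSite 2 L, ψ i (latticeMomentum L q) * torusChar q ((fun j => (((x j).val : ℕ) : ZMod L)) - ybar)) := by
    rw [sectorPullback_apply_zero_one, Fintype.sum_prod_type]
    refine Finset.sum_congr rfl fun i _ => ?_
    exact (Finset.sum_congr rfl fun q _ => sectorSummand_zero_one_eq hβ 𝔣 Φ FL hFL pL hpL x₀ y₀ _ ybar ω ω' σ ψ hψ i q).trans
      (sum_gridSummand_eq hβ _ (ψ i) _)
  simp_rw [hfine]
  rw [hcoarse, Finset.sum_comm]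
  refine Finset.sum_congr rfl fun i _ => ?_
  rw [← Finset.mul_sum, periodise_spatialPropagator hLf (ψ i) x ybar]

/-- **The `(−,+)` entries of the sector-field covariance periodise EXACTLY between nested tori** (fibre in the second leg; spatial character `χ(y⃗′ − x⃗)`,
`periodise_spatialPropagator_left`). [folklore] -/
theorem sectorPullback_one_zero_periodise [NeZero M] (hLf : Lf = b * L) {β : ℝ} (hβ : β ≠ 0)
    (𝔣 : Fin Ns → MatsubaraIdx M → (Fin 2 → ℝ) → ℂ) (Φ : MatsubaraIdx M → Fin 2 → (Fin 2 → ℝ) → ℂ)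
    (FL : Fin Ns → FreqMomentum L M → ℂ) (FLf : Fin Ns → FreqMomentum Lf M → ℂ)
    (hFL : ∀ ω i q, FL ω (i, q) = 𝔣 ω i (latticeMomentum L q)) (hFLf : ∀ ω i q, FLf ω (i, q) = 𝔣 ω i (latticeMomentum Lf q))
    (pL : FreqMomentum L M × Fin 2 → ℂ) (pLf : FreqMomentum Lf M × Fin 2 → ℂ)
    (hpL : ∀ i q σ, pL ((i, q), σ) = ((β * (L : ℝ) ^ 2 : ℝ) : ℂ) * Φ i σ (latticeMomentum L q))
    (hpLf : ∀ i q σ, pLf ((i, q), σ) = ((β * (Lf : ℝ) ^ 2 : ℝ) : ℂ) * Φ i σ (latticeMomentum Lf q))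
    (x₀ y₀ : ImagTimeIdx M) (x : TorusSite 2 Lf) (ybar : TorusSite 2 L) (ω ω' : Fin Ns) (σ : Fin 2) :
    ∑ y' ∈ univ.filter (fun y' : TorusSite 2 Lf => (fun i => (((y' i).val : ℕ) : ZMod L)) = ybar),
        ((sectorSubMatrix Lf M β FLf).transpose * normalCovariance Lf M pLf * sectorSubMatrix Lf M β FLf)
          ((x₀, x), ((ω, σ), 1)) ((y₀, y'), ((ω', σ), 0)) =
      ((sectorSubMatrix L M β FL).transpose * normalCovariance L M pL * sectorSubMatrix L M β FL)
        ((x₀, fun i => (((x i).val : ℕ) : ZMod L)), ((ω, σ), 1)) ((y₀, ybar), ((ω', σ), 0)) := by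
  obtain ⟨ψ, hψ⟩ : ∃ ψ : MatsubaraIdx M → (Fin 2 → ℝ) → ℂ, ∀ i q', 𝔣 ω i q' * 𝔣 ω' i q' * Φ i σ q' = ψ i q' := ⟨_, fun _ _ => rfl⟩
  have hfine : ∀ y' : TorusSite 2 Lf,
      ((sectorSubMatrix Lf M β FLf).transpose * normalCovariance Lf M pLf * sectorSubMatrix Lf M β FLf)
          ((x₀, x), ((ω, σ), 1)) ((y₀, y'), ((ω', σ), 0)) =
        ∑ i : MatsubaraIdx M,
          -(Complex.exp (((Real.pi * (1 - 2 * M) * (((y₀ : ℕ) : ℝ) - ((x₀ : ℕ) : ℝ)) / (2 * M) : ℝ) : ℂ) * I) *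
              torusChar (fun _ : Fin 1 => ((i : ℕ) : ZMod (2 * M))) (fun _ : Fin 1 => ((y₀ : ℕ) : ZMod (2 * M)) - ((x₀ : ℕ) : ZMod (2 * M)))) /
              (β : ℂ) *
            (((Lf : ℂ) ^ 2)⁻¹ * ∑ q : TorusSite 2 Lf, ψ i (latticeMomentum Lf q) * torusChar q (y' - x)) := by
    intro y'
    rw [sectorPullback_apply_one_zero, Fintype.sum_prod_type]
    refine Finset.sum_congr rfl fun i _ => ?_
    exact (Finset.sum_congr rfl fun q _ => sectorSummand_one_zero_eq hβ 𝔣 Φ FLf hFLf pLf hpLf x₀ y₀ x y' ω ω' σ ψ hψ i q).trans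
      (sum_gridSummand_eq hβ _ (ψ i) (y' - x))
  have hcoarse :
      ((sectorSubMatrix L M β FL).transpose * normalCovariance L M pL * sectorSubMatrix L M β FL)
          ((x₀, fun i => (((x i).val : ℕ) : ZMod L)), ((ω, σ), 1)) ((y₀, ybar), ((ω', σ), 0)) =
        ∑ i : MatsubaraIdx M,
          -(Complex.exp (((Real.pi * (1 - 2 * M) * (((y₀ : ℕ) : ℝ) - ((x₀ : ℕ) : ℝ)) / (2 * M) : ℝ) : ℂ) * I) *
              torusChar (fun _ : Fin 1 => ((i : ℕ) : ZMod (2 * M))) (fun _ : Fin 1 => ((y₀ : ℕ) : ZMod (2 * M)) - ((x₀ : ℕ) : ZMod (2 * M)))) /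
              (β : ℂ) *
            (((L : ℂ) ^ 2)⁻¹ * ∑ q : TorusSite 2 L, ψ i (latticeMomentum L q) * torusChar q (ybar - fun j => (((x j).val : ℕ) : ZMod L))) := by
    rw [sectorPullback_apply_one_zero, Fintype.sum_prod_type]
    refine Finset.sum_congr rfl fun i _ => ?_
    exact (Finset.sum_congr rfl fun q _ => sectorSummand_one_zero_eq hβ 𝔣 Φ FL hFL pL hpL x₀ y₀ _ ybar ω ω' σ ψ hψ i q).trans
      (sum_gridSummand_eq hβ _ (ψ i) _)
  simp_rw [hfine]
  rw [hcoarse, Finset.sum_comm]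
  refine Finset.sum_congr rfl fun i _ => ?_
  rw [← Finset.mul_sum, periodise_spatialPropagator_left hLf (ψ i) x ybar]

/-! ## §3 (P) at every pair of legs -/

/-- **(P) AT EVERY PAIR OF SECTOR-FIELD LEGS.**  For `Lf = b·L`, `β ≠ 0`, the same sampled multiplier family `𝔣` (e.g. the anisotropic family of a
common frame, `klAnisoFamily_eq_sampled`) and the same sampled symbol `Φ` (e.g. a slice of the frame propagator) at both volumes, and any block
structure `e` of the sector-field labels whose projection is `((x₀, x⃗), ℓ) ↦ ((x₀, red x⃗), ℓ)`: the fine sector-field covariance summed over the fibre of a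
coarse label is the coarse one — `Σ_{π Y″ = Y} C′ X′ Y″ = C (π X′) Y` (hypothesis `hP` of `sum_norm_kernel_twoVolume_step_le` /
`sum_norm_kernel_sub_copies_le_response`). [folklore] -/
theorem sectorPullback_periodise_leg [NeZero M] (hLf : Lf = b * L) {β : ℝ} (hβ : β ≠ 0)
    (𝔣 : Fin Ns → MatsubaraIdx M → (Fin 2 → ℝ) → ℂ) (Φ : MatsubaraIdx M → Fin 2 → (Fin 2 → ℝ) → ℂ)
    (FL : Fin Ns → FreqMomentum L M → ℂ) (FLf : Fin Ns → FreqMomentum Lf M → ℂ)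
    (hFL : ∀ ω i q, FL ω (i, q) = 𝔣 ω i (latticeMomentum L q)) (hFLf : ∀ ω i q, FLf ω (i, q) = 𝔣 ω i (latticeMomentum Lf q))
    (pL : FreqMomentum L M × Fin 2 → ℂ) (pLf : FreqMomentum Lf M × Fin 2 → ℂ)
    (hpL : ∀ i q σ, pL ((i, q), σ) = ((β * (L : ℝ) ^ 2 : ℝ) : ℂ) * Φ i σ (latticeMomentum L q))
    (hpLf : ∀ i q σ, pLf ((i, q), σ) = ((β * (Lf : ℝ) ^ 2 : ℝ) : ℂ) * Φ i σ (latticeMomentum Lf q))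
    {ι : Type*} (e : (SpaceTimeIdx Lf M × SectorLeg Ns) ≃ ι × (SpaceTimeIdx L M × SectorLeg Ns))
    (he2 : ∀ X', (e X').2 = ((X'.1.1, fun i => (((X'.1.2 i).val : ℕ) : ZMod L)), X'.2))
    (X' : SpaceTimeIdx Lf M × SectorLeg Ns) (Y : SpaceTimeIdx L M × SectorLeg Ns) :
    ∑ Y'' ∈ univ.filter (fun Y'' : SpaceTimeIdx Lf M × SectorLeg Ns => (e Y'').2 = Y),
        ((sectorSubMatrix Lf M β FLf).transpose * normalCovariance Lf M pLf * sectorSubMatrix Lf M β FLf) X' Y'' =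
      ((sectorSubMatrix L M β FL).transpose * normalCovariance L M pL * sectorSubMatrix L M β FL) (e X').2 Y := by
  classical
  rw [sum_fibre_sectorField e he2, he2]
  obtain ⟨⟨x₀, x⟩, ⟨⟨ω, σ⟩, c⟩⟩ := X'
  obtain ⟨⟨y₀, ybar⟩, ⟨⟨ω', σ'⟩, c'⟩⟩ := Y
  dsimp only
  by_cases hσ : σ = σ'
  · subst hσ
    by_cases hc : c = c'
    · rw [pullback_normalCovariance_apply_of_charge_eq β FL pL
        (Y := ((x₀, fun i => (((x i).val : ℕ) : ZMod L)), ((ω, σ), c))) (Y' := ((y₀, ybar), ((ω', σ), c'))) hc]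
      exact sum_eq_zero fun x' _ => pullback_normalCovariance_apply_of_charge_eq β FLf pLf hc
    · fin_cases c <;> fin_cases c'
      · exact absurd rfl hc
      · simp only [Fin.isValue, Fin.mk_one, Fin.zero_eta]
        exact sectorPullback_zero_one_periodise hLf hβ 𝔣 Φ FL FLf hFL hFLf pL pLf hpL hpLf x₀ y₀ x ybar ω ω' σ
      · simp only [Fin.isValue, Fin.mk_one, Fin.zero_eta]
        exact sectorPullback_one_zero_periodise hLf hβ 𝔣 Φ FL FLf hFL hFLf pL pLf hpL hpLf x₀ y₀ x ybar ω ω' σ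
      · exact absurd rfl hc
  · rw [sectorPullback_apply_of_spin_ne β FL pL
      (Y := ((x₀, fun i => (((x i).val : ℕ) : ZMod L)), ((ω, σ), c))) (Y' := ((y₀, ybar), ((ω', σ'), c'))) hσ]
    exact sum_eq_zero fun x' _ => sectorPullback_apply_of_spin_ne β FLf pLf hσ

end Pullback

/-! ## §4 The far geometry (G1)/(G2) on the sector-field labels -/

section Far

variable {b L Lf M Ns : ℕ} [NeZero Lf]

/-- **(G1) on sector-field labels**: for a block structure `e` with block `⌊x⃗/L⌋`, labels in different blocks, not both in the zone `{not R-deep}`, are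
far: `R < tnorm (site X′ − site Y′)`. [folklore] -/
theorem sector_far_of_block_ne (hLf : Lf = b * L)
    (e : (SpaceTimeIdx Lf M × SectorLeg Ns) ≃ (Fin 2 → Fin b) × (SpaceTimeIdx L M × SectorLeg Ns))
    (he1 : ∀ X' i, ((e X').1 i : ℕ) = (X'.1.2 i).val / L) {R : ℕ} {X' Y' : SpaceTimeIdx Lf M × SectorLeg Ns} (hne : (e X').1 ≠ (e Y').1)
    (hnz : ¬ ((¬ ∀ j, R ≤ (X'.1.2 j).val % L ∧ (X'.1.2 j).val % L + R < L) ∧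
              (¬ ∀ j, R ≤ (Y'.1.2 j).val % L ∧ (Y'.1.2 j).val % L + R < L))) :
    R < Torus.tnorm (X'.1.2 - Y'.1.2) := by
  obtain ⟨i, hi⟩ : ∃ i, (e X').1 i ≠ (e Y').1 i := by
    by_contra h; push Not at h; exact hne (funext h)
  have hblk : (X'.1.2 i).val / L ≠ (Y'.1.2 i).val / L := by
    rw [← he1, ← he1]; exact fun h => hi (Fin.ext h)
  refine tnorm_sub_gt_of_block_ne hLf hblk ?_
  by_contra h; exact hnz ⟨fun hA => h (Or.inl hA), fun hB => h (Or.inr hB)⟩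

/-- **(G2) on sector-field labels**: inside a block, a label `Y″ ≠ Y′` of the fibre of `Y′` is a WINDING image of `Y′` (same time, same sector leg, same
residues), hence far from every `X′` of the block when not both of `X′, Y′` are in the zone: `R < tnorm (site X′ − site Y″)`. [folklore] -/
theorem sector_far_of_fibre_ne (hLf : Lf = b * L)
    (e : (SpaceTimeIdx Lf M × SectorLeg Ns) ≃ (Fin 2 → Fin b) × (SpaceTimeIdx L M × SectorLeg Ns))
    (he1 : ∀ X' i, ((e X').1 i : ℕ) = (X'.1.2 i).val / L)
    (he2 : ∀ X', (e X').2 = ((X'.1.1, fun i => (((X'.1.2 i).val : ℕ) : ZMod L)), X'.2))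
    {R : ℕ} {X' Y' Y'' : SpaceTimeIdx Lf M × SectorLeg Ns} (hblk : (e X').1 = (e Y').1) (hfib : (e Y'').2 = (e Y').2) (hne : Y'' ≠ Y')
    (hnz : ¬ ((¬ ∀ j, R ≤ (X'.1.2 j).val % L ∧ (X'.1.2 j).val % L + R < L) ∧
              (¬ ∀ j, R ≤ (Y'.1.2 j).val % L ∧ (Y'.1.2 j).val % L + R < L))) :
    R < Torus.tnorm (X'.1.2 - Y''.1.2) := by
  rw [he2, he2] at hfib; simp only [Prod.mk.injEq] at hfib
  obtain ⟨⟨hj, hred⟩, hℓ⟩ := hfib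
  -- the sites differ (else the labels would coincide)
  have hsite : Y''.1.2 ≠ Y'.1.2 := fun h => hne (Prod.ext (Prod.ext hj h) hℓ)
  obtain ⟨i, hi⟩ : ∃ i, Y''.1.2 i ≠ Y'.1.2 i := by
    by_contra h; push Not at h; exact hsite (funext h)
  have hredi : (((Y''.1.2 i).val : ℕ) : ZMod L) = (((Y'.1.2 i).val : ℕ) : ZMod L) := congr_fun hred i
  have hbY : (Y''.1.2 i).val / L ≠ (Y'.1.2 i).val / L := fun h => hi (apply_eq_of_red_eq_of_block_eq hredi h)
  have hbX : (X'.1.2 i).val / L = (Y'.1.2 i).val / L := by rw [← he1, ← he1, hblk]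
  have hblk' : (X'.1.2 i).val / L ≠ (Y''.1.2 i).val / L := by rw [hbX]; exact fun h => hbY h.symm
  have hresi : (Y''.1.2 i).val % L = (Y'.1.2 i).val % L := (ZMod.natCast_eq_natCast_iff' _ _ _).1 hredi
  refine lt_of_lt_of_le ?_ (natAbs_cRepZ_apply_le_tnorm (X'.1.2 - Y''.1.2) i)
  rw [Pi.sub_apply]
  refine Nat.lt_of_succ_le (succ_le_natAbs_cRepZ_sub_of_block_ne hLf hblk' ?_)
  by_contra h; apply hnz
  refine ⟨fun hX => h (Or.inl (hX i)), fun hY => h (Or.inr ?_)⟩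
  have := hY i; rwa [← hresi] at this

end Far

/-! ## §5 The programme's anisotropic multiplier family is sampled -/

section Symbols

open Summit.HubbardSuperconductivity.HubbardSuperconductivity.Theorems.KLProgrammeLegKernels

/-- **The anisotropic sector multipliers of a frame `K` are SAMPLED**: `bgmMultiplier V M e₀ β (e_K) n ω (i, q) = 𝔣 ω i (p_q)` with ONE `𝔣` for every volume
`V` (the radial cutoff reads `√(ω_i² + e_K(p_q)²)`, `e_K(p) = −2Σcos p_j − μ − K(p)`; the angular weight reads the polar angle of the centred representative of
`p_q`) — the hypothesis `hFL`/`hFLf` of `sectorPullback_periodise_leg` for `klAnisoFamily V M β μ K e₀ n` at a COMMON frame. [folklore] -/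
theorem bgmMultiplier_nambuXiCT_eq_sampled {V M : ℕ} (e₀ β μ : ℝ) (K : TrigPolyC4v) (n : ℕ) (ω : Fin (sectorCount n)) (i : MatsubaraIdx M)
    (q : TorusSite 2 V) :
    bgmMultiplier V M e₀ β (nambuXiCT V μ K) n ω (i, q) =
      (fun (ω' : Fin (sectorCount n)) (i' : MatsubaraIdx M) (p : Fin 2 → ℝ) =>
        (((gnScaleCutoff 4 e₀ (-(n : ℤ)) (Real.sqrt (matsubaraFreq β M i' ^ 2 + (-2 * ∑ j, Real.cos (p j) - μ - K.eval p) ^ 2)) *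
            sectorWeightCirc n ω' (polarAngle (fun j => toIocMod Real.two_pi_pos (-Real.pi) (p j))) : ℝ) : ℂ)))
        ω i (latticeMomentum V q) := by
  simp only [bgmMultiplier, momentumAngle, nambuXiCT, torusBand]
  rfl

/-- The programme's anisotropic family `klAnisoFamily V M β μ K e₀ n` is sampled (same `𝔣` at every volume). [folklore] -/
theorem klAnisoFamily_eq_sampled {V M : ℕ} [NeZero V] (β μ : ℝ) (K : TrigPolyC4v) (e₀ : ℝ) (n : ℕ) (ω : Fin (sectorCount n)) (i : MatsubaraIdx M)
    (q : TorusSite 2 V) :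
    klAnisoFamily V M β μ K e₀ n ω (i, q) =
      (fun (ω' : Fin (sectorCount n)) (i' : MatsubaraIdx M) (p : Fin 2 → ℝ) =>
        (((gnScaleCutoff 4 e₀ (-(n : ℤ)) (Real.sqrt (matsubaraFreq β M i' ^ 2 + (-2 * ∑ j, Real.cos (p j) - μ - K.eval p) ^ 2)) *
            sectorWeightCirc n ω' (polarAngle (fun j => toIocMod Real.two_pi_pos (-Real.pi) (p j))) : ℝ) : ℂ)))
        ω i (latticeMomentum V q) := by
  rw [klAnisoFamily]; exact bgmMultiplier_nambuXiCT_eq_sampled e₀ β μ K n ω i q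

end Symbols

end Summit.HubbardSuperconductivity.HubbardSuperconductivity.Theorems.TwoPointAssembly

end
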